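import Literature.AlgebraicGeometry.Deligne1982.CMDenseMumfordTateFamilies
import Literature.AlgebraicGeometry.HodgeTheory.DirectImageBaseChangeSections
import Literature.AlgebraicGeometry.HodgeTheory.DirectImageTransport
import Literature.AlgebraicGeometry.HodgeTheory.IsoTransport
import Literature.AlgebraicGeometry.HodgeTheory.MotivatedClassesDeformationInputs
import Literature.AlgebraicGeometry.Motives.FlatSubfamilyProofs
import Literature.AlgebraicGeometry.Motives.ComplexPointsManifold
import Literature.AlgebraicGeometry.Motives.VarietiesDimensionProofs
import Literature.NumberTheory.Transcendental.AnalytificationConnectedProofs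
import HarnessLib

/-!
# Ring 2 — hypotheses layer: transport lemmas for the Mumford–Tate CM anchors (row b01) along base change

HONEST FRAMING: research route conditional on HC_CM; not a corollary; Q11.4-sentence-2 already refuted in dim ≥ 3.

Cell `pub-hodge-ring2`, binder-prover seat `ring2-b01` (gen 7), BINDER-OWNERS row b01
(`Ring2.Hypotheses.MumfordTateCMAnchors`, Deligne 1982 Prop. 6.1 / Charles–Schnell Thm. 11.5.11 in
GLOBAL-CLASS form). `HC_CM` (`Theses.RankFourFaces.CMAbelianHodge`) does not occur in this file; nothing
here proves a case of the Hodge conjecture. No definition, no named fact, no `sorry`.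

## What this part adds (module 1 of 2 of gen 7)

The data of row b01 — an abelian chart `A' ≅ 𝒳_s` at every fibre, a CM fibre (`Deligne1982.cmLocus`),
the anchor `e : A ≅ 𝒳_{s₁}` with `e^*(class at s₁) = c` — move along ANY base change `g : S' ⟶ S`
(`Motives.familyPullback`, fibre identification `Motives.fiberOverFamilyPullbackIso`), both for global
classes and for values of continuous sections of the espace étalé `FiberClass f k` of `Rᵏ f_* ℂ`
(`FiberClass.baseChange`). Two further elementary facts used by module 2
(`Ring2HypothesesMTAnchorsOfFlatSections`): over a base with ONE complex point the fibre inclusion is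
surjective on `H^k(–(ℂ); ℂ)` (it is a homeomorphism on complex points), and a `ℂ`-scheme smooth of
POSITIVE relative dimension has two distinct complex points (its complex points form a real
`2m`-manifold), so that a smooth irreducible `ℂ`-scheme with one complex point has dimension `0`.

* `exists_abelianChart_familyPullback`, `mem_cmLocus_familyPullback_iff` — charts and the CM locus under
  base change (the CM locus of `𝒳 ×_S S' ⟶ S'` is the preimage of that of `f`).
* `exists_anchor_of_baseChange_eq`, `exists_anchor_of_eq_globalSection`, `prop_iff_of_eq_globalSection`,
  `exists_anchor_of_eq_mk` — the anchor clause `∃ e : Y ≅ 𝒳_{x.pt}, e^* x.cls = c` moves along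
  `FiberClass.baseChange … x' = x`, along `σ t = globalSection f k β t`, and out of the chart form
  `σ s₁ = ⟨s₁, (e⁻¹)^* c⟩`.
* `surjective_complexBetti_map_fiberι_of_subsingleton` — one-point base.
* `exists_ne_of_smoothOfRelativeDimension_pos`, `topologicalKrullDim_eq_zero_of_subsingleton_complexPoints` —
  positive-dimensional smooth schemes have two complex points; one complex point forces dimension `0`.

Sources: [Hartshorne1977] II §3 (base extension, fibres); [VoisinHodgeII2003] §3.1.1–3.1.2 (inverse image
of a local system); [SerreGAGA1956] §2 n°5–6 (complex points of a smooth scheme form a manifold);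
[GortzWedhorn2020] Lemma 6.26 (dimension of smooth schemes).
-/

-- every declaration of this problem lives in `Summit.HodgeConjecture.HodgeConjecture.…` (summit = sub-problem)
set_option linter.dupNamespace false

noncomputable section

open CategoryTheory AlgebraicGeometry Topology Filter
open Literature.AlgebraicGeometry Literature.AlgebraicGeometry.Motives Literature.AlgebraicGeometry.HodgeTheory
open Literature.AlgebraicTopology.SingularHomology

namespace Summit.HodgeConjecture.HodgeConjecture.Ring2.Hypotheses

/-! ## §1 Abelian charts and the CM locus under base change -/

section BaseChange

variable {n : ℕ} {𝒳 S S' : SchemeOver ℂ} (f : 𝒳 ⟶ S) (g : S' ⟶ S)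

/-- **Abelian charts move along base change**: if every fibre of `f` is charted by an `n`-dimensional complex
abelian variety, so is every fibre of `𝒳 ×_S S' ⟶ S'` (the fibre over `t` is the fibre of `f` over `g t`,
`Motives.fiberOverFamilyPullbackIso`). [cite: Hartshorne1977, II §3 (base extension)] -/
theorem exists_abelianChart_familyPullback
    (hab : ∀ s : ComplexPoints S, ∃ A' : AbelianVariety ℂ, A'.dim = n ∧ Nonempty (A'.X ≅ fiberOver f s))
    (t : ComplexPoints S') :
    ∃ A' : AbelianVariety ℂ, A'.dim = n ∧ Nonempty (A'.X ≅ fiberOver (familyPullback.snd f g) t) := by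
  obtain ⟨A', hA', ⟨i⟩⟩ := hab (AlgPoints.map g t)
  exact ⟨A', hA', ⟨i ≪≫ (fiberOverFamilyPullbackIso f g t).symm⟩⟩

/-- **The CM locus of the base change is the preimage of the CM locus** (pointwise): `t` is a CM point of
`𝒳 ×_S S' ⟶ S'` iff `g t` is a CM point of `f` (same fibre up to `fiberOverFamilyPullbackIso`).
[cite: Deligne1982HodgeCycles, §6 proof of Prop. 6.1 (p. 73)] -/
theorem mem_cmLocus_familyPullback_iff (t : ComplexPoints S') :
    t ∈ Deligne1982.cmLocus (familyPullback.snd f g) n ↔ AlgPoints.map g t ∈ Deligne1982.cmLocus f n := by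
  constructor
  · rintro ⟨A₀, ⟨i⟩, hdim, hcm⟩
    exact ⟨A₀, ⟨i ≪≫ fiberOverFamilyPullbackIso f g t⟩, hdim, hcm⟩
  · rintro ⟨A₀, ⟨i⟩, hdim, hcm⟩
    exact ⟨A₀, ⟨i ≪≫ (fiberOverFamilyPullbackIso f g t).symm⟩, hdim, hcm⟩

end BaseChange

/-! ## §2 The anchor clause along pulled-back sections and along global sections -/

section Anchor

variable {k : ℕ} {𝒳 S S' Y : SchemeOver ℂ} (f : 𝒳 ⟶ S) (g : S' ⟶ S)

/-- **The anchor moves along a pulled-back section.** If the transfer of the fibre class `x'` of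
`𝒳 ×_S S' ⟶ S'` is the fibre class `x` of `f` (`FiberClass.baseChange f g k x' = x`) and `x.cls` is the class
`c` of `Y` under some isomorphism `e : Y ≅ 𝒳_{x.pt}`, then `x'.cls` is `c` under an isomorphism
`Y ≅ (𝒳 ×_S S')_{x'.pt}` (compose with `fiberOverFamilyPullbackIso`; functoriality of pull-back).
[cite: VoisinHodgeII2003, §3.1.2] -/
theorem exists_anchor_of_baseChange_eq {x' : FiberClass (familyPullback.snd f g) k} {x : FiberClass f k}
    (h : FiberClass.baseChange f g k x' = x) (c : complexBetti Y k)
    (hx : ∃ e : Y ≅ fiberOver f x.pt, complexBetti.map e.hom k x.cls = c) :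
    ∃ e' : Y ≅ fiberOver (familyPullback.snd f g) x'.pt, complexBetti.map e'.hom k x'.cls = c := by
  have h' : (⟨AlgPoints.map g x'.pt,
      complexBetti.map (fiberOverFamilyPullbackIso f g x'.pt).inv k x'.cls⟩ : FiberClass f k) =
      ⟨x.pt, x.cls⟩ := h
  obtain ⟨e, he⟩ := (FiberClass.prop_iff_of_mk_eq
    (fun t d => ∃ e : Y ≅ fiberOver f t, complexBetti.map e.hom k d = c) h').2 hx
  refine ⟨e ≪≫ (fiberOverFamilyPullbackIso f g x'.pt).symm, ?_⟩
  rw [Iso.trans_hom, Iso.symm_hom, complexBetti.map_comp, ModuleCat.comp_apply]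
  exact he

/-- **The anchor moves along an identification with a global section.** If `σ t = globalSection f k β t`
and the value `(σ t).cls` is `c` under some `e : Y ≅ 𝒳_{(σ t).pt}`, then `β|_{𝒳_t}` is `c` under some
`e' : Y ≅ 𝒳_t`. [folklore] -/
theorem exists_anchor_of_eq_globalSection {σ : ComplexPoints S → FiberClass f k} {t : ComplexPoints S}
    {β : complexBetti 𝒳 k} (h : σ t = globalSection f k β t) (c : complexBetti Y k)
    (hx : ∃ e : Y ≅ fiberOver f (σ t).pt, complexBetti.map e.hom k (σ t).cls = c) :
    ∃ e' : Y ≅ fiberOver f t, complexBetti.map e'.hom k (complexBetti.map (fiberι f t) k β) = c := by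
  have h' : (⟨(σ t).pt, (σ t).cls⟩ : FiberClass f k) = ⟨t, complexBetti.map (fiberι f t) k β⟩ := h
  exact (FiberClass.prop_iff_of_mk_eq
    (fun u d => ∃ e : Y ≅ fiberOver f u, complexBetti.map e.hom k d = c) h').1 hx

/-- Along `σ t = globalSection f k β t`, a fibrewise predicate holds at `(σ t).pt, (σ t).cls` iff it holds
at `t, β|_{𝒳_t}` (`FiberClass.prop_iff_of_mk_eq`). [folklore] -/
theorem prop_iff_of_eq_globalSection (P : ∀ u : ComplexPoints S, complexBetti (fiberOver f u) k → Prop)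
    {σ : ComplexPoints S → FiberClass f k} {t : ComplexPoints S} {β : complexBetti 𝒳 k}
    (h : σ t = globalSection f k β t) :
    P (σ t).pt (σ t).cls ↔ P t (complexBetti.map (fiberι f t) k β) := by
  have h' : (⟨(σ t).pt, (σ t).cls⟩ : FiberClass f k) = ⟨t, complexBetti.map (fiberι f t) k β⟩ := h
  exact FiberClass.prop_iff_of_mk_eq P h'

/-- **The anchor in chart form.** If the section passes through `(s₁, (e⁻¹)^* c)` for a chart `e : Y ≅ 𝒳_{s₁}` —
`σ s₁ = ⟨s₁, (e⁻¹)^* c⟩`, the non-dependent way of saying "`e^*(σ(s₁)) = c`" — then the value `(σ s₁).cls` is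
`c` under an isomorphism `Y ≅ 𝒳_{(σ s₁).pt}` (namely `e`, read through the equality; `e^* (e⁻¹)^* c = c`).
[folklore] -/
theorem exists_anchor_of_eq_mk {σ : ComplexPoints S → FiberClass f k} {s₁ : ComplexPoints S}
    (e : Y ≅ fiberOver f s₁) (c : complexBetti Y k) (h : σ s₁ = ⟨s₁, complexBetti.map e.inv k c⟩) :
    ∃ e' : Y ≅ fiberOver f (σ s₁).pt, complexBetti.map e'.hom k (σ s₁).cls = c := by
  have h' : (⟨(σ s₁).pt, (σ s₁).cls⟩ : FiberClass f k) = ⟨s₁, complexBetti.map e.inv k c⟩ := h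
  exact (FiberClass.prop_iff_of_mk_eq
    (fun u d => ∃ e' : Y ≅ fiberOver f u, complexBetti.map e'.hom k d = c) h').2
    ⟨e, e.complexBetti_map_hom_map_inv k c⟩

end Anchor

/-! ## §3 One-point bases: the fibre inclusion is surjective on cohomology -/

section OnePoint

variable {𝒳 S : SchemeOver ℂ} (f : 𝒳 ⟶ S)

/-- **Over a base with one complex point the fibre inclusion is surjective on `Hᵏ(–(ℂ); ℂ)`.** For `f`
proper with `𝒳(ℂ)` Hausdorff and `S(ℂ) = {s}`, the complex points of the fibre `𝒳_s` map HOMEOMORPHICALLY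
onto the topological fibre `f(ℂ)⁻¹(s) = 𝒳(ℂ)` (`Motives.exists_fiberHomeomorph`), so `(𝒳_s ↪ 𝒳)^*` is a
bijection. [cite: MumfordRedBook1999, I.10 Thm. 2] -/
theorem surjective_complexBetti_map_fiberι_of_subsingleton [IsProper f.left] [T2Space (ComplexPoints 𝒳)]
    (s : ComplexPoints S) (hS : ∀ t : ComplexPoints S, t = s) (k : ℕ) :
    Function.Surjective (complexBetti.map (fiberι f s) k) := by
  have huniv : (AlgPoints.map f ⁻¹' {s} : Set (ComplexPoints 𝒳)) = Set.univ :=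
    Set.eq_univ_of_forall fun x => hS _
  obtain ⟨e, he⟩ := exists_fiberHomeomorph f s
  -- the homeomorphism `𝒳_s(ℂ) ≃ₜ 𝒳(ℂ)`
  let E : ComplexPoints (fiberOver f s) ≃ₜ ComplexPoints 𝒳 :=
    (e.trans (Homeomorph.setCongr huniv)).trans (Homeomorph.Set.univ (ComplexPoints 𝒳))
  have hE : (E : C(ComplexPoints (fiberOver f s), ComplexPoints 𝒳)) =
      AlgPoints.mapContinuous (L := ℂ) (fiberι f s) :=
    ContinuousMap.ext fun x => he x
  intro a
  refine ⟨singularCohomology.map ℂ ℂ (E.symm : C(ComplexPoints 𝒳, ComplexPoints (fiberOver f s))) k a, ?_⟩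
  change singularCohomology.map ℂ ℂ (AlgPoints.mapContinuous (L := ℂ) (fiberι f s)) k _ = a
  rw [← hE, ← ModuleCat.comp_apply, ← singularCohomology.map_comp]
  have h : (E.symm : C(ComplexPoints 𝒳, ComplexPoints (fiberOver f s))).comp
      (E : C(ComplexPoints (fiberOver f s), ComplexPoints 𝒳)) = ContinuousMap.id _ :=
    ContinuousMap.ext fun x => E.symm_apply_apply x
  rw [h, singularCohomology.map_id]
  rfl

end OnePoint

/-! ## §4 Complex points of smooth schemes of positive dimension -/

section Points

/-- **A `ℂ`-scheme smooth of positive relative dimension has, next to any complex point, another one**: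
`S(ℂ)` is a real `2m`-manifold (`Motives.ComplexPoints.chartedSpace`, Serre GAGA §2), and a chart domain
around `P` maps onto an open subset of `ℝ^{2m}`, `2m ≥ 1`, which is not a single point.
[cite: SerreGAGA1956, §2 n°5 Prop. 2 and n°6] -/
theorem exists_ne_of_smoothOfRelativeDimension_pos (S : SchemeOver ℂ) [LocallyOfFiniteType S.hom] {m : ℕ}
    [SmoothOfRelativeDimension m S.hom] (hm : 0 < m) (P : ComplexPoints S) :
    ∃ Q : ComplexPoints S, Q ≠ P := by
  letI := Motives.ComplexPoints.chartedSpace S m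
  by_contra hcon
  push Not at hcon
  -- the chart at `P` has open target containing `chartAt P P`; its target is a subsingleton
  set φ := chartAt (EuclideanSpace ℝ (Fin (2 * m))) P with hφ
  have htgt : IsOpen φ.target := φ.open_target
  have hmem : φ P ∈ φ.target := φ.map_source (mem_chart_source _ P)
  obtain ⟨ε, hε, hball⟩ := Metric.isOpen_iff.1 htgt (φ P) hmem
  -- a second point of the ball
  haveI : Nontrivial (EuclideanSpace ℝ (Fin (2 * m))) :=
    Module.nontrivial_of_finrank_pos (R := ℝ) (by rw [finrank_euclideanSpace_fin]; omega)
  obtain ⟨v, hv⟩ : ∃ v : EuclideanSpace ℝ (Fin (2 * m)), ‖v‖ = ε / 2 :=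
    exists_norm_eq _ (le_of_lt (half_pos hε))
  have hv0 : v ≠ 0 := by
    intro h0
    have : ‖v‖ = 0 := by rw [h0, norm_zero]
    rw [hv] at this
    linarith
  have hmem' : φ P + v ∈ φ.target := by
    apply hball
    rw [Metric.mem_ball, dist_eq_norm, add_sub_cancel_left, hv]
    linarith
  -- pull it back to `S(ℂ)`
  have hQ : φ.symm (φ P + v) ∈ φ.source := φ.map_target hmem'
  have hQP : φ.symm (φ P + v) = P := hcon _
  have : φ P + v = φ P := by
    have h1 := φ.right_inv hmem'
    rw [hQP] at h1
    exact h1.symm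
  exact hv0 (by simpa using this)

/-- **A smooth irreducible `ℂ`-scheme with at most one complex point has dimension `0`**: it is smooth of
some relative dimension `m` (`exists_smoothOfRelativeDimension_of_connectedSpace_complexPoints`, `S(ℂ)` being
connected), `m = 0` by `exists_ne_of_smoothOfRelativeDimension_pos`, and `dim S = m`
(`Motives.topologicalKrullDim_eq_of_smoothOfRelativeDimension`). [cite: GortzWedhorn2020, Lemma 6.26] -/
theorem topologicalKrullDim_eq_zero_of_subsingleton_complexPoints (S : SchemeOver ℂ) [IrreducibleSpace S.left]
    [AlgebraicGeometry.Smooth S.hom] (s : ComplexPoints S) (hS : ∀ t : ComplexPoints S, t = s) :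
    topologicalKrullDim S.left = 0 := by
  haveI : LocallyOfFiniteType S.hom := inferInstance
  haveI : ConnectedSpace (ComplexPoints S) := (ComplexPoints.connectedSpace_iff_holds S).2 inferInstance
  obtain ⟨m, hm⟩ := exists_smoothOfRelativeDimension_of_connectedSpace_complexPoints S
  haveI := hm
  have hm0 : m = 0 := by
    by_contra hne
    obtain ⟨Q, hQ⟩ := exists_ne_of_smoothOfRelativeDimension_pos S (Nat.pos_of_ne_zero hne) s
    exact hQ (hS Q)
  subst hm0
  have h := Motives.topologicalKrullDim_eq_of_smoothOfRelativeDimension S.hom 0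
  exact_mod_cast h

end Points

end Summit.HodgeConjecture.HodgeConjecture.Ring2.Hypotheses

end
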